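import Summits.HubbardSuperconductivity.HubbardSuperconductivity.Theorems.TwistGapTgTwistCeiling
import Summits.HubbardSuperconductivity.HubbardSuperconductivity.Theorems.DeformationLadderLowEnergyRigidityKernelStates
import Literature.Barriers.HubbardSuperconductivity.PureModelStripeCompetitionProofs

/-!
# `LowEnergyRigidity` (crux stmt-HubbardSuperconductivity-1892, route `DeformationLadder`):
# the energy window is load-bearing and must be `O(1)` — negative-side support (refuter,
# crux-disprover seat)

`LowEnergyRigidity` claims: `∃ U>0, δ∈(0,½), κ>0, a>0, L₀, ∀ even L ≥ L₀`, every unit vector `φ` of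
`szSector N_L 0` (`N_L = 2⌊(1-δ)L²/2⌋`) with `Re⟨φ, H_L φ⟩ ≤ minEnergyOn H_L (szSector N_L 0) + κ`
(`H_L = hubbardTorus 2 L 1 U`) has `a ≤ L⁻⁴ Re⟨φ, Δ_dᴴΔ_d φ⟩` (`Δ_d = pairField dWaveFormFactor L`).

Here we record, sorry-free, what happens to the crux's own matrix when the WINDOW is tampered with
(all statements inline; no proposition is defined under `Summits/`):

* `cube_order_mul_window_le_of_rigid` — ONE side suffices for the twist constraint: if the matrix
  holds at a single side `L ≥ 2⌈(κ/64)^{1/3}⌉₊ + 1` with data `(U, δ, κ, a)`, `κ > 0`, `δ ≥ -1`,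
  then `a³ κ ≤ 64·(32π² + 32)³` (cube of the provers' `rigidity_scale_le_twistCeiling`).
* `lowEnergyRigidity_false_with_large_order` — hence for every PRESCRIBED pair `(κ, a)` with
  `a³κ > 64(32π²+32)³` the crux matrix is false at every `(U, δ)` and every `L₀` (tightness: the
  witnesses live in `a ≤ 4(32π²+32) κ^{-1/3}`).
* `lowEnergyRigidity_false_with_unbounded_window` — replacing the constant window `κ` by ANY
  side-dependent window `w L` unbounded along the even sides makes the matrix false at every
  `(U, δ, a)`; corollaries `…_with_window_tendsto` (`w → +∞`) and `…_with_pow_window`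
  (`w L = κ·L^α`, `α > 0`; `α = 2` = a positive excitation-energy DENSITY).
* `lowEnergyRigidity_false_without_window` — dropping the window altogether is false at every
  `(U, δ, a)`, by the explicit unit KERNEL state of `Δ_d` in `szSector N_L 0`
  (`hcf_exists_unit_kernel_state`), whose LRO density is exactly `0`.

Moral for provers: any proof of `LowEnergyRigidity` must use the window as an `O(L⁰)` quantity
(no energy-density / thermal-type input can reach it), must place `κ` below the twist scale
(`a³κ ≤ 64C³`), and conversely the crux admits no strengthening towards growing windows, in any
model, superconducting or not. This file does NOT refute the crux.

References: Lieb–Schultz–Mattis, Ann. Phys. 16 (1961) 407, App. B (twists); the tree's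
`TwistGapTgTwistCeiling` and `DeformationLadderLowEnergyRigidityKernelStates`.
-/

noncomputable section

set_option linter.dupNamespace false

namespace Summit.HubbardSuperconductivity.HubbardSuperconductivity.Theorems.LowEnergyRigidity.Negative

open Literature.MathematicalPhysics.QuantumLattice Matrix Filter Literature.Barriers.HubbardSuperconductivity
open Summit.HubbardSuperconductivity.HubbardSuperconductivity.Theorems
open Summit.HubbardSuperconductivity.HubbardSuperconductivity.Theorems.DeformationLadder

/-- **One side suffices for the twist constraint.** If the rigidity matrix of the crux holds at ONE
side `L ≥ 2⌈(κ/64)^{1/3}⌉₊ + 1` with data `(U, δ, κ, a)`, `κ > 0`, `δ ≥ -1`, then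
`a³ κ ≤ 64·(32π² + 32)³` (cube `a·(κ/64) ≤ C (κ/64)^{2/3}`, `rigidity_scale_le_twistCeiling`, and
cancel `(κ/64)²`). Lieb–Schultz–Mattis (1961) App. B. [folklore] -/
theorem cube_order_mul_window_le_of_rigid {U δ κ a : ℝ} (hκ : 0 < κ) (hδ : -1 ≤ δ) {L : ℕ}
    [NeZero L] (hL : 2 * ⌈(κ / 64) ^ (1 / 3 : ℝ)⌉₊ + 1 ≤ L)
    (hrig : ∀ φ : Fock (Orb (FermionTorus 2 L)),
      φ ∈ szSector (2 * ⌊(1 - δ) * (L : ℝ) ^ 2 / 2⌋₊) 0 → star φ ⬝ᵥ φ = 1 →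
        (star φ ⬝ᵥ Matrix.mulVec (hubbardTorus 2 L 1 U) φ).re ≤
          (hubbardTorus 2 L 1 U).minEnergyOn (szSector (2 * ⌊(1 - δ) * (L : ℝ) ^ 2 / 2⌋₊) 0) + κ →
        a ≤ (expect ((pairField dWaveFormFactor L)ᴴ * pairField dWaveFormFactor L) φ).re /
          (L : ℝ) ^ 4) :
    a ^ 3 * κ ≤ 64 * (32 * Real.pi ^ 2 + 32) ^ 3 := by
  have hs : 0 < κ / 64 := by positivity
  have hmain := rigidity_scale_le_twistCeiling U δ hκ L hL (natFloor_filling_le_sq hδ L) hrig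
  set C : ℝ := 32 * Real.pi ^ 2 + 32 with hC
  set s : ℝ := κ / 64 with hs_def
  have hC0 : 0 ≤ C := by positivity
  by_cases ha0 : a ≤ 0
  · have h1 : a ^ 3 * κ ≤ 0 :=
      mul_nonpos_of_nonpos_of_nonneg (Odd.pow_nonpos (by decide : Odd 3) ha0) hκ.le
    have h2 : (0 : ℝ) ≤ 64 * C ^ 3 := by positivity
    linarith
  push Not at ha0
  have h3 := pow_le_pow_left₀ (mul_nonneg ha0.le hs.le) hmain 3
  have hs2 : (s ^ (2 / 3 : ℝ)) ^ 3 = s ^ 2 := by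
    rw [← Real.rpow_natCast, ← Real.rpow_mul hs.le]; norm_num
  rw [mul_pow, mul_pow, hs2] at h3
  have hs3 : 0 < s ^ 2 := by positivity
  have h4 : a ^ 3 * s ≤ C ^ 3 := by
    have h5 : a ^ 3 * s * s ^ 2 ≤ C ^ 3 * s ^ 2 := by nlinarith [h3]
    exact le_of_mul_le_mul_right h5 hs3
  have : a ^ 3 * κ = 64 * (a ^ 3 * s) := by rw [hs_def]; ring
  rw [this]
  nlinarith [h4]

/-- **Tightness of the corner crux: the over-ordered strengthening is false.** For every
prescribed pair `(κ, a)` with `a³ κ > 64·(32π² + 32)³`, the matrix of `LowEnergyRigidity` with that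
`(κ, a)` fails at EVERY `U`, every `δ > -1` (in particular on `(0,½)`) and every `L₀`: test it at
one even side beyond `L₀` and the twist threshold. So every witness `(U, δ, κ, a, L₀)` of the crux
has `a ≤ 4(32π²+32)·κ^{-1/3}`: the quantitative form of "the one-flux twist forces `κ` below the
stiffness scale". Lieb–Schultz–Mattis (1961) App. B. [folklore] -/
theorem lowEnergyRigidity_false_with_large_order {κ a : ℝ} (hκ : 0 < κ)
    (hlarge : 64 * (32 * Real.pi ^ 2 + 32) ^ 3 < a ^ 3 * κ) :
    ¬ ∃ U : ℝ, ∃ δ : ℝ, -1 < δ ∧ ∃ L₀ : ℕ, ∀ (L : ℕ) [NeZero L], L₀ ≤ L → Even L →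
      ∀ φ : Fock (Orb (FermionTorus 2 L)),
        φ ∈ szSector (2 * ⌊(1 - δ) * (L : ℝ) ^ 2 / 2⌋₊) 0 → star φ ⬝ᵥ φ = 1 →
        (star φ ⬝ᵥ Matrix.mulVec (hubbardTorus 2 L 1 U) φ).re ≤
          (hubbardTorus 2 L 1 U).minEnergyOn (szSector (2 * ⌊(1 - δ) * (L : ℝ) ^ 2 / 2⌋₊) 0) + κ →
        a ≤ (expect ((pairField dWaveFormFactor L)ᴴ * pairField dWaveFormFactor L) φ).re /
          (L : ℝ) ^ 4 := by
  rintro ⟨U, δ, hδ, L₀, h⟩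
  set L₁ : ℕ := 2 * ⌈(κ / 64) ^ (1 / 3 : ℝ)⌉₊ + 1 with hL₁
  set L : ℕ := 2 * (max L₀ L₁ + 1) with hLdef
  have hLpos : 0 < L := by rw [hLdef]; omega
  haveI : NeZero L := ⟨hLpos.ne'⟩
  have hL0 : L₀ ≤ L := by
    have := le_max_left L₀ L₁; rw [hLdef]; omega
  have hL1 : L₁ ≤ L := by
    have := le_max_right L₀ L₁; rw [hLdef]; omega
  have hev : Even L := ⟨max L₀ L₁ + 1, by rw [hLdef]; ring⟩
  have := cube_order_mul_window_le_of_rigid hκ hδ.le (hL₁ ▸ hL1) (h L hL0 hev)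
  linarith

/-- **Unbounded windows are false at every `(U, δ, a)`.** If `w : ℕ → ℝ` is unbounded along the
even sides (`∀ M L₀, ∃ even L ≥ L₀, M ≤ w L`), then the matrix of `LowEnergyRigidity` with the
constant window `κ` replaced by `w L` fails for every `U`, every `δ > -1`, every `a > 0` and every
`L₀`: at a side where `w L ≥ M := 64((C+1)/a)³`, `C = 32π² + 32`, the matrix with window `M` holds
a fortiori, and the one-side twist ceiling gives `a·(M/64) ≤ C·(M/64)^{2/3}`, i.e. `C + 1 ≤ C`.
Lieb–Schultz–Mattis (1961) App. B. [folklore] -/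
theorem lowEnergyRigidity_false_with_unbounded_window (w : ℕ → ℝ)
    (hw : ∀ (M : ℝ) (L₀ : ℕ), ∃ L : ℕ, L₀ ≤ L ∧ Even L ∧ M ≤ w L) :
    ¬ ∃ U : ℝ, ∃ δ : ℝ, -1 < δ ∧ ∃ a : ℝ, 0 < a ∧ ∃ L₀ : ℕ, ∀ (L : ℕ) [NeZero L], L₀ ≤ L →
      Even L → ∀ φ : Fock (Orb (FermionTorus 2 L)),
        φ ∈ szSector (2 * ⌊(1 - δ) * (L : ℝ) ^ 2 / 2⌋₊) 0 → star φ ⬝ᵥ φ = 1 →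
        (star φ ⬝ᵥ Matrix.mulVec (hubbardTorus 2 L 1 U) φ).re ≤
          (hubbardTorus 2 L 1 U).minEnergyOn (szSector (2 * ⌊(1 - δ) * (L : ℝ) ^ 2 / 2⌋₊) 0) +
            w L →
        a ≤ (expect ((pairField dWaveFormFactor L)ᴴ * pairField dWaveFormFactor L) φ).re /
          (L : ℝ) ^ 4 := by
  rintro ⟨U, δ, hδ, a, ha, L₀, h⟩
  set C : ℝ := 32 * Real.pi ^ 2 + 32 with hC
  have hC0 : 0 < C := by positivity
  set t : ℝ := (C + 1) / a with ht
  have ht0 : 0 < t := by positivity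
  set M : ℝ := 64 * t ^ 3 with hM
  have hM0 : 0 < M := by positivity
  set L₁ : ℕ := 2 * ⌈(M / 64) ^ (1 / 3 : ℝ)⌉₊ + 1 with hL₁
  obtain ⟨L, hL, hev, hwL⟩ := hw M (max L₀ L₁ + 1)
  have hLpos : 0 < L := by omega
  haveI : NeZero L := ⟨hLpos.ne'⟩
  have hL0 : L₀ ≤ L := by have := le_max_left L₀ L₁; omega
  have hL1 : L₁ ≤ L := by have := le_max_right L₀ L₁; omega
  -- the matrix with the smaller, constant window `M`
  have hrig : ∀ φ : Fock (Orb (FermionTorus 2 L)),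
      φ ∈ szSector (2 * ⌊(1 - δ) * (L : ℝ) ^ 2 / 2⌋₊) 0 → star φ ⬝ᵥ φ = 1 →
        (star φ ⬝ᵥ Matrix.mulVec (hubbardTorus 2 L 1 U) φ).re ≤
          (hubbardTorus 2 L 1 U).minEnergyOn (szSector (2 * ⌊(1 - δ) * (L : ℝ) ^ 2 / 2⌋₊) 0) + M →
        a ≤ (expect ((pairField dWaveFormFactor L)ᴴ * pairField dWaveFormFactor L) φ).re /
          (L : ℝ) ^ 4 :=
    fun φ hφ hφ1 hE => h L hL0 hev φ hφ hφ1 (hE.trans (by linarith))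
  have hmain := rigidity_scale_le_twistCeiling U δ hM0 L (hL₁ ▸ hL1)
    (natFloor_filling_le_sq hδ.le L) hrig
  have h64 : M / 64 = t ^ 3 := by rw [hM]; ring
  have h23 : (t ^ 3) ^ (2 / 3 : ℝ) = t ^ 2 := by
    rw [← Real.rpow_natCast, ← Real.rpow_mul ht0.le]; norm_num
  rw [h64, h23] at hmain
  have hat : a * t = C + 1 := by rw [ht]; field_simp
  have ht2 : 0 < t ^ 2 := by positivity
  have : (C + 1) * t ^ 2 ≤ C * t ^ 2 := by
    calc (C + 1) * t ^ 2 = a * t ^ 3 := by rw [← hat]; ring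
      _ ≤ C * t ^ 2 := hmain
  nlinarith

/-- **Windows tending to `+∞` are false** (corollary: such windows are unbounded along the even
sides). [folklore] -/
theorem lowEnergyRigidity_false_with_window_tendsto (w : ℕ → ℝ) (hw : Tendsto w atTop atTop) :
    ¬ ∃ U : ℝ, ∃ δ : ℝ, -1 < δ ∧ ∃ a : ℝ, 0 < a ∧ ∃ L₀ : ℕ, ∀ (L : ℕ) [NeZero L], L₀ ≤ L →
      Even L → ∀ φ : Fock (Orb (FermionTorus 2 L)),
        φ ∈ szSector (2 * ⌊(1 - δ) * (L : ℝ) ^ 2 / 2⌋₊) 0 → star φ ⬝ᵥ φ = 1 →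
        (star φ ⬝ᵥ Matrix.mulVec (hubbardTorus 2 L 1 U) φ).re ≤
          (hubbardTorus 2 L 1 U).minEnergyOn (szSector (2 * ⌊(1 - δ) * (L : ℝ) ^ 2 / 2⌋₊) 0) +
            w L →
        a ≤ (expect ((pairField dWaveFormFactor L)ᴴ * pairField dWaveFormFactor L) φ).re /
          (L : ℝ) ^ 4 := by
  refine lowEnergyRigidity_false_with_unbounded_window w fun M L₀ => ?_
  obtain ⟨N, hN⟩ := eventually_atTop.1 (tendsto_atTop.1 hw M)
  refine ⟨2 * max N L₀, ?_, even_two_mul _, hN _ ?_⟩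
  · have := le_max_right N L₀; omega
  · have := le_max_left N L₀; omega

/-- **Power windows `κ·L^α` (`κ > 0`, `α > 0`) are false at every `(U, δ, a)`** — in particular
the extensive window `κL²` (a positive excitation-energy density) never forces `d`-wave LRO: the
exponent `0` of the crux's window `κ·L⁰` is sharp. [folklore] -/
theorem lowEnergyRigidity_false_with_pow_window {κ α : ℝ} (hκ : 0 < κ) (hα : 0 < α) :
    ¬ ∃ U : ℝ, ∃ δ : ℝ, -1 < δ ∧ ∃ a : ℝ, 0 < a ∧ ∃ L₀ : ℕ, ∀ (L : ℕ) [NeZero L], L₀ ≤ L →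
      Even L → ∀ φ : Fock (Orb (FermionTorus 2 L)),
        φ ∈ szSector (2 * ⌊(1 - δ) * (L : ℝ) ^ 2 / 2⌋₊) 0 → star φ ⬝ᵥ φ = 1 →
        (star φ ⬝ᵥ Matrix.mulVec (hubbardTorus 2 L 1 U) φ).re ≤
          (hubbardTorus 2 L 1 U).minEnergyOn (szSector (2 * ⌊(1 - δ) * (L : ℝ) ^ 2 / 2⌋₊) 0) +
            κ * (L : ℝ) ^ α →
        a ≤ (expect ((pairField dWaveFormFactor L)ᴴ * pairField dWaveFormFactor L) φ).re /
          (L : ℝ) ^ 4 :=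
  lowEnergyRigidity_false_with_window_tendsto (fun L => κ * (L : ℝ) ^ α)
    (((tendsto_rpow_atTop hα).comp tendsto_natCast_atTop_atTop).const_mul_atTop hκ)

/-- **Without the window the matrix is false at every `(δ, a)`** (the coupling `U` no longer
occurs; `δ ∈ (0, 1]` so that the sector leaves three empty rows): for even `L ≥ max(L₀, 2, 3/δ)` the occupation-basis state with the
`↑` electrons on the first `⌊(1-δ)L²/2⌋` sites and the `↓` electrons two rows further
(`hcf_exists_unit_kernel_state`) is a unit vector of `szSector N_L 0` annihilated by `Δ_d`; its LRO
density is exactly `0 < a`. So the energy window of `LowEnergyRigidity` is load-bearing already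
kinematically: the kernel of the order parameter meets the sector. [folklore] -/
theorem lowEnergyRigidity_false_without_window :
    ¬ ∃ δ : ℝ, 0 < δ ∧ δ ≤ 1 ∧ ∃ a : ℝ, 0 < a ∧ ∃ L₀ : ℕ, ∀ (L : ℕ) [NeZero L], L₀ ≤ L →
      Even L → ∀ φ : Fock (Orb (FermionTorus 2 L)),
        φ ∈ szSector (2 * ⌊(1 - δ) * (L : ℝ) ^ 2 / 2⌋₊) 0 → star φ ⬝ᵥ φ = 1 →
        a ≤ (expect ((pairField dWaveFormFactor L)ᴴ * pairField dWaveFormFactor L) φ).re /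
          (L : ℝ) ^ 4 := by
  rintro ⟨δ, hδ0, hδ1, a, ha, L₀, h⟩
  set L₁ : ℕ := ⌈3 / δ⌉₊ + 2 with hL₁
  set L : ℕ := 2 * max L₀ L₁ with hLdef
  have hL1 : L₁ ≤ L := by have := le_max_right L₀ L₁; omega
  have hL0 : L₀ ≤ L := by have := le_max_left L₀ L₁; omega
  have hL2 : 2 ≤ L := by omega
  haveI : NeZero L := ⟨by omega⟩
  have hev : Even L := even_two_mul _
  have hδL : 3 ≤ δ * L := by
    have h1 : 3 / δ ≤ (L₁ : ℝ) := by
      rw [hL₁]; push_cast; linarith [Nat.le_ceil (3 / δ)]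
    have h2 : (L₁ : ℝ) ≤ L := by exact_mod_cast hL1
    have h3 : 3 / δ ≤ (L : ℝ) := h1.trans h2
    rw [div_le_iff₀ hδ0] at h3
    linarith [mul_comm (L : ℝ) δ]
  set m : ℕ := ⌊(1 - δ) * (L : ℝ) ^ 2 / 2⌋₊ with hm
  have hmle : 2 * m + 3 * L ≤ L ^ 2 := by
    have h1 : (m : ℝ) ≤ (1 - δ) * (L : ℝ) ^ 2 / 2 := by
      rw [hm]
      refine Nat.floor_le ?_
      have : 0 ≤ 1 - δ := by linarith
      positivity
    have h2 : (2 * m + 3 * L : ℝ) ≤ (L : ℝ) ^ 2 := by nlinarith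
    exact_mod_cast h2
  obtain ⟨φ, hφS, hφ1, hφ0⟩ := hcf_exists_unit_kernel_state L hL2 hmle
  have hLRO := h L hL0 hev φ hφS hφ1
  have hzero : expect ((pairField dWaveFormFactor L)ᴴ * pairField dWaveFormFactor L) φ = 0 := by
    simp only [Literature.MathematicalPhysics.QuantumLattice.expect]
    rw [← mulVec_mulVec, hφ0, mulVec_zero, dotProduct_zero]
  rw [hzero, Complex.zero_re, zero_div] at hLRO
  exact absurd hLRO (not_le.2 ha)

end Summit.HubbardSuperconductivity.HubbardSuperconductivity.Theorems.LowEnergyRigidity.Negative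

end
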